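import Literature.IUT.HodgeTheaters.PuncturedEllipticCoveringsCor12OfFreeProCommutatorCusp
import Literature.IUT.HodgeTheaters.PuncturedEllipticCoveringsCor12UniqueDoubleCover
import HarnessLib

/-!
# [IUTchI] Cor. 1.2 at the genuine `K`-level data over the three ORIGIN LAWS of the once-punctured elliptic curve
# and its `±1`-quotient: `hrank′`, `hΔ`, `hΔ′`, print-`htf`, `hIH′`, `huniq` all DISCHARGED — proof-only knit

Mochizuki, *Inter-universal Teichmüller theory I*, kurims manuscript (May 2020), §1 pp. 37–39, Cor. 1.2 and its proof
p. 39 l. 19–46 [cite: Mochizuki2012, IUTchI Cor 1.2 p.39] (D-0012 claim key; series status DISPUTED — nothing of the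
series is asserted here).

PROOF-ONLY knit (cell abc-iut, seat abc-iut-L5-t1 gen 11; HUB census `plan/L5/SUBDAG-IUTchI-Cor12.md` §R) of the
two parallel repairs of tonight's Cor. 1.2 closer chain at the GENUINE `K`-level data of two initial Θ-data:
abc-iut-f-090's `InitialThetaData.pe_characteristicNatureOfCoverings_viaX_of_freePro_faithful_commutatorCusp` (p494126:
`hIH′` DISCHARGED from the commutator-cusp origin datum (c′)) and this seat's
`PuncturedEllipticData.huniq_of_torsionGenerated_of_isFreeProOn` (p494272: the [AbsTopII] Cor. 3.3 (ii) uniqueness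
law `huniq` DISCHARGED from the origin law (e) "`Δ_C` is topologically generated by its torsion").  The resulting
closer `InitialThetaData.pe_characteristicNatureOfCoverings_of_originLaws` displays EXACTLY:
* DATA: the cusp interfaces `C C′` (abc-iut-L5-t1 `CuspGalois`) and ONE cuspidal algorithm `A`;
* ORIGIN / FACT-INSTANCE-shaped classical inputs of the specific curves: `hfree hfree′` («`Δ_X ≅ F̂₂` free profinite
  on two generators», [SGA1 XIII 2.12] / [AbsTopI] Lem. 4.5 (i) `IsFreeProOn`, census object (A)), `hcusp′` ((c′):
  every cusp inertia group of `X̲′` is a `Δ′_X`-conjugate of `⟨[a,b]⟩⁻`, [AbsTopIII] Prop. 1.4 (i) shape), `hgenC′`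
  ((e): `Δ′_C ≤ (closure {torsion of Δ′_C})⁻`, the orbicurve `C′ = X′/{±1}`, `Δ_{C′} ≅ (ℤ/2∗ℤ/2∗ℤ/2)^`);
* FACT rows BY NAME: `hA hA′` ([AbsTopI] Lem. 4.5 (v) `RecoversCusps`, F-0206, at the two `X̲`-extensions);
* GAP rows: `h0 h0′` (ramification of `ε⁰`, GAP-LEDGER G-L5d4g6-1);
* LAWS: `hL L′` (abc-iut-L5-t1's six printed `Δ_ε`-level laws `ModLCuspLaws`; (L0) and (L1) are separately
  theorems of (A)/(c′) in p494126 / p491462 but the record is consumed whole) and `hext hextC` ([AbsTopII] Cor. 3.3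
  (i) extension form — L5 row R7, keyed to abc-iut-f-052).
Versus the certificate conjunct of record `layer5_held_cor12_v6` (14 LAW): `hrank′ hΔ hΔ′ htf huniq′ hIH′` are GONE
(theorems of the origin laws), NO binder is vacuous (T1g11-F1 repaired), LAW-shaped binders 8 of which 2 FACT rows
and 2 GAP ids ⇒ 4 genuine laws `hL L′ hext hextC` + 4 origin/instance inputs `hfree hfree′ hcusp′ hgenC′`.

HONEST FRAMING: a by-name composition; binders are assumption labels (origin laws are properties of the specific
curves, not theorems about every `PuncturedEllipticData`); typed ≠ discharged for the anabelian inputs; nothing here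
bears on [IUTchIII] Cor. 3.12 or asserts that abc is proved or refuted.  No `def`, no instance, no new `Prop` fact.
-/

noncomputable section

namespace Literature.IUT.HodgeTheaters.InitialThetaData

open scoped Pointwise
open Literature.AnabelianGeometry.AbsoluteAnabelian
open Literature.AnabelianGeometry.AbsoluteAnabelian.FundamentalExtension (CuspidalAlgorithm)

universe u u'

variable {F : Type u} {K : Type} {Fbar : Type} [Field F] [NumberField F] [Field K] [NumberField K]
  [Algebra F K] [Field Fbar] [Algebra F Fbar] [Algebra K Fbar]
  {E : WeierstrassCurve F} [E.IsElliptic] {l : ℕ} {Pb : BadPlacePredicates K}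
  (D : InitialThetaData F K Fbar E l Pb)
  {F' : Type u'} {K' : Type} [Field F'] [NumberField F'] [Field K'] [NumberField K'] [Algebra F' K']
  {Fbar' : Type} [Field Fbar'] [Algebra F' Fbar'] [Algebra K' Fbar']
  {E' : WeierstrassCurve F'} [E'.IsElliptic] {l' : ℕ} {Pb' : BadPlacePredicates K'}
  (D' : InitialThetaData F' K' Fbar' E' l' Pb')

/-- **[IUTchI] Cor. 1.2 between the `K`-level data of two initial Θ-data, over the ORIGIN LAWS (A), (c′), (e)**:
abc-iut-f-090's commutator-cusp closer (p494126) with the [AbsTopII] Cor. 3.3 (ii) uniqueness law `huniq`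
DISCHARGED by `PuncturedEllipticData.huniq_of_torsionGenerated_of_isFreeProOn` (p494272) from `hgenC′` ("`Δ′_C` is
topologically generated by its elements of finite order") and `hfree′`.  Displayed: DATA `C C′ A`; origin/instance
`hfree hfree′ hcusp′ hgenC′`; FACT `hA hA′` (F-0206); GAP `h0 h0′` (G-L5d4g6-1); LAW `hL L′ hext hextC`.
([IUTchI] Cor 1.2 p.39) [claim: Mochizuki2012, status: disputed] -/
theorem pe_characteristicNatureOfCoverings_of_originLaws
    (C : D.geom.pe.CuspGalois) (C' : D'.geom.pe.CuspGalois)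
    (hL : D.geom.pe.ModLCuspLaws) (L' : D'.geom.pe.ModLCuspLaws)
    {gens : Fin 2 → ↥(D.geom.pe.PiX ⊓ D.geom.pe.DeltaC)}
    (hfree : IsFreeProOn ↥(D.geom.pe.PiX ⊓ D.geom.pe.DeltaC) Set.univ gens)
    {gens' : Fin 2 → ↥(D'.geom.pe.PiX ⊓ D'.geom.pe.DeltaC)}
    (hfree' : IsFreeProOn ↥(D'.geom.pe.PiX ⊓ D'.geom.pe.DeltaC) Set.univ gens')
    (hcusp' : ∀ x : D'.geom.pe.Cusp, ∃ g ∈ D'.geom.pe.PiX ⊓ D'.geom.pe.DeltaC,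
      D'.geom.pe.inertia x = (Subgroup.zpowers (g * ((gens' 0 : D'.geom.pe.PiC) * (gens' 1 : D'.geom.pe.PiC) *
        (gens' 0 : D'.geom.pe.PiC)⁻¹ * (gens' 1 : D'.geom.pe.PiC)⁻¹) * g⁻¹)).topologicalClosure)
    (hgenC' : D'.geom.pe.DeltaC ≤ (Subgroup.closure
      {g : D'.geom.pe.PiC | g ∈ D'.geom.pe.DeltaC ∧ IsOfFinOrder g}).topologicalClosure)
    (h0 : ¬ D.geom.pe.inertia D.geom.pe.ε0 ≤ D.geom.pe.piXarrow)
    (h0' : ¬ D'.geom.pe.inertia D'.geom.pe.ε0 ≤ D'.geom.pe.piXarrow)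
    (hext : ∀ φ : D.geom.pe.piXarrow ≃* D'.geom.pe.piXarrow, Continuous φ → Continuous φ.symm →
      ∃ Θ : D.geom.pe.PiC ≃ₜ* D'.geom.pe.PiC,
        ∀ x : D.geom.pe.piXarrow, Θ (x : D.geom.pe.PiC) = (φ x : D'.geom.pe.PiC))
    (hextC : ∀ ψ : D.geom.pe.piCarrow ≃* D'.geom.pe.piCarrow, Continuous ψ → Continuous ψ.symm →
      ∃ Θ : D.geom.pe.PiC ≃ₜ* D'.geom.pe.PiC,
        ∀ x : D.geom.pe.piCarrow, Θ (x : D.geom.pe.PiC) = (ψ x : D'.geom.pe.PiC))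
    (A : CuspidalAlgorithm.{0}) (hA : A.RecoversCusps D.geom.pe.extXbar C.cuspidalDataXbar)
    (hA' : A.RecoversCusps D'.geom.pe.extXbar C'.cuspidalDataXbar) :
    D.geom.pe.CharacteristicNatureOfCoverings D'.geom.pe :=
  D.pe_characteristicNatureOfCoverings_viaX_of_freePro_faithful_commutatorCusp D' C C' hL L' hfree hfree' hcusp'
    h0 h0' (D'.geom.pe.huniq_of_torsionGenerated_of_isFreeProOn hgenC' hfree') hext hextC A hA hA'

end Literature.IUT.HodgeTheaters.InitialThetaData
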